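import Summits.AtomisticToContinuum.HydrodynamicLimit.Theorems.OneFlightGossipEngineEnergyCurrentTailsDocking
import Summits.AtomisticToContinuum.HydrodynamicLimit.Theorems.JParityClosureOddContactSymmetryGibbsInvariance
import Literature.MathematicalPhysics.KineticTheory.HardSphereTwoTimePressure
import Mathlib.MeasureTheory.Measure.Haar.Unique
import HarnessLib

/-!
# The marginal form of the exergy influence bound (line `IdeatorThreeSketch`, crux
# `EnergyCurrentTails`, stmt-AtomisticToContinuum-9235)

Helper file of the line lead (prover-line-stmt-AtomisticToContinuum-9235-0) for the registered audit
stub `stub_marginalEnvelope_iff` of `Cruxes/EnergyCurrentTails/Lines/IdeatorThreeSketch.lean`.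

The line's open transfer statement C⁺ (`stub_exergyInfluence`, card `loschmidt-tagging-exergy`) is
typed on the side of the INVARIANT homogeneous Gibbs law `G = localGibbsLaw σ a 0 θr`: for the
density `F = dλ_N/dG` of the local Gibbs data and every one-particle velocity observable `g ≥ 0`,
`∫ g(vᵢ) F(flip(Φ_s z)) dG ≤ C ∫ g(vᵢ) e^{β|vᵢ|²/2} dG`, `βθr < 1`.  This file proves that C⁺ is
EQUIVALENT to its reading on the side of the evolved law (`stub_marginalEnvelope_iff`):

  MARGINAL ENVELOPE — for `N ≥ N₀`, `s ∈ [0,t]`, every particle `i` and every measurable `g ≥ 0`,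
  `E_{λ_N}[g(vᵢ(s))] ≤ C ∫ g(w) e^{β|w|²/2} N(0, θr I₃)(dw)`,

i.e. a GAUSSIAN ENVELOPE `C·N(0, θ' I₃)`, `1/θ' = 1/θr − β > 0`, of the one-particle velocity
marginals of the deterministically evolved local Gibbs law, uniformly in `N ≥ N₀` and `s ≤ t < T`
(pre-shock).  So the open content of the line is exactly this N-uniform Maxwellian upper bound
(the in-expectation, one-time shadow of `HighMomentumCutoff`; no likelihood ratio, no reference law
and no identity is needed to STATE it — the tagging identity is the tool proposed to PROVE it).

Ingredients: the general (non-even) form of the Loschmidt tagging identity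
`∫ g(vᵢ) F(flip Φ_s z) dG = ∫ g(−vᵢ(Φ_s w)) F(w) dG(w)` (`lintegral_mul_density_flipVel_flow`:
stationarity of `G` under the flow, `Theorems.measurePreserving_flow_localGibbsLaw_const`;
reversibility `ae_flow_flipVel_localGibbsLaw`; `flip`-invariance of `G`,
`measurePreserving_flipVel_localGibbsLaw`); existence of the density of the local Gibbs law w.r.t.
the homogeneous one (`exists_density_localGibbsLaw`, ratio of the two canonical densities, the
reference being positive on the hard-sphere domain for `σ ≤ 1/2`); reflection symmetry of the
centred Gaussian (`lintegral_comp_neg_gaussMeasure_zero`); and the one-body velocity marginal of `G`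
(`lintegral_vel_localGibbsLaw_const`, landed with the docking stub).

References: C. Cercignani, R. Illner, M. Pulvirenti, *The Mathematical Theory of Dilute Gases*
(1994) §4.2; H. Spohn, *Large Scale Dynamics of Interacting Particles* (1991) Part I §2.3.
-/

noncomputable section

open MeasureTheory Set Filter
open scoped ENNReal

namespace Summit.AtomisticToContinuum.HydrodynamicLimit.Theorems.LoschmidtTagging

open Literature.MathematicalPhysics.KineticTheory Literature.Analysis.FluidPDE

/-! ## §1 The tagging identity for a general one-particle observable -/

/-- **Loschmidt tagging, general form.**  For the homogeneous Gibbs law `G = localGibbsLaw σ a 0 θ`,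
every flow `Φ`, every measurable `F, g ≥ 0`, every time `s` and particle `i`:
`∫ g(vᵢ(z)) F(flip(Φ_s z)) dG(z) = ∫ g(−vᵢ(Φ_s w)) d(F·G)(w)` — the tested functional of C⁺ is the
expectation of `g(−vᵢ(s))` under the law with density `F`.  (For even `g` this is the registered
`stub_tagging`.) -/
theorem lintegral_mul_density_flipVel_flow (σ a θ : ℝ) (N : ℕ)
    (Φ : HardSphereFlow (Torus.geometry (Fin 3)) (hsDiameter σ N) (N + 1))
    {F : Config (N + 1) (Fin 3) T3 → ℝ≥0∞} (hF : Measurable F)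
    {g : V3 → ℝ≥0∞} (hg : Measurable g) (s : ℝ) (i : Fin (N + 1)) :
    ∫⁻ z, g ((z i).2) * F (flipVel (Φ.flow s z))
        ∂(localGibbsLaw σ (fun _ => a) (fun _ => 0) (fun _ => θ) N Φ)
      = ∫⁻ w, g (-((Φ.flow s w i).2))
          ∂((localGibbsLaw σ (fun _ => a) (fun _ => 0) (fun _ => θ) N Φ).withDensity F) := by
  set G := localGibbsLaw σ (fun _ => a) (fun _ => 0) (fun _ => θ) N Φ with hG
  have hSe := measurableEmbedding_flipVel (X := T3) (d := Fin 3) (N := N + 1)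
  have hR := measurePreserving_flipVel_localGibbsLaw σ (fun _ => a) (fun _ => θ) N Φ
  have hΦ := Summit.AtomisticToContinuum.HydrodynamicLimit.Theorems.measurePreserving_flow_localGibbsLaw_const
    σ a θ (0 : V3) N Φ (-s)
  have hrev := ae_flow_flipVel_localGibbsLaw σ (fun _ => a) (fun _ => (0 : V3)) (fun _ => θ) N Φ s
  have hgood := ae_mem_good_localGibbsLaw σ (fun _ => a) (fun _ => (0 : V3)) (fun _ => θ) N Φ
  have hvel : ∀ t : ℝ, Measurable fun z : Config (N + 1) (Fin 3) T3 => (Φ.flow t z i).2 := fun t =>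
    measurable_snd.comp ((measurable_pi_apply i).comp (Φ.measurable_flow t))
  have hgm : Measurable fun z : Config (N + 1) (Fin 3) T3 => g (-((Φ.flow s z i).2)) :=
    hg.comp (hvel s).neg
  have hh : Measurable fun z : Config (N + 1) (Fin 3) T3 => F z * g (-((Φ.flow s z i).2)) :=
    hF.mul hgm
  rw [lintegral_withDensity_eq_lintegral_mul _ hF hgm]
  symm
  calc ∫⁻ w, (F * fun z => g (-((Φ.flow s z i).2))) w ∂G
      = ∫⁻ w, F w * g (-((Φ.flow s w i).2)) ∂G := rfl
    _ = ∫⁻ y, F (Φ.flow (-s) y) * g (-((Φ.flow s (Φ.flow (-s) y) i).2)) ∂G := by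
        rw [← lintegral_map hh (Φ.measurable_flow (-s)), hΦ.map_eq]
    _ = ∫⁻ y, F (Φ.flow (-s) y) * g (-((y i).2)) ∂G := by
        refine lintegral_congr_ae ?_
        filter_upwards [hgood] with y hy
        have h1 := Φ.flow_neg_flow (-s) hy
        rw [neg_neg] at h1
        rw [h1]
    _ = ∫⁻ y, F (flipVel (Φ.flow s (flipVel y))) * g (-((y i).2)) ∂G := by
        refine lintegral_congr_ae ?_
        filter_upwards [hrev] with y hy
        rw [hy, flipVel_flipVel]
    _ = ∫⁻ y, F (flipVel (Φ.flow s (flipVel (flipVel y)))) * g (-(((flipVel y) i).2)) ∂G :=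
        (hR.lintegral_comp_emb hSe
          (fun y => F (flipVel (Φ.flow s (flipVel y))) * g (-((y i).2)))).symm
    _ = ∫⁻ z, g ((z i).2) * F (flipVel (Φ.flow s z)) ∂G := by
        refine lintegral_congr fun y => ?_
        rw [flipVel_flipVel, mul_comm]
        simp only [flipVel_apply, neg_neg]

/-! ## §2 The density of the local Gibbs law w.r.t. the homogeneous one -/

variable {a₀ θ₀ : T3 → ℝ} {u₀ : T3 → V3}

/-- The homogeneous canonical density is POSITIVE on the hard-sphere domain (`σ ≤ 1/2`, `a > 0`,
`θr > 0`: positive partition function, positive Maxwellians). -/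
theorem canonicalDensity_const_pos {σ : ℝ} (hσ2 : σ ≤ 1 / 2) {a θr : ℝ} (ha : 0 < a)
    (hθr : 0 < θr) (N : ℕ) {z : Config (N + 1) (Fin 3) T3}
    (hz : z ∈ hardSphereDomain (Torus.geometry (Fin 3)) (N + 1) (hsDiameter σ N)) :
    0 < canonicalDensity (Torus.geometry (Fin 3)) (hsDiameter σ N) (N + 1)
      (localGibbsProfile (fun _ => a) (fun _ => (0 : V3)) (fun _ => θr)) z := by
  have hZ : 0 < canonicalPartition (Torus.geometry (Fin 3)) (hsDiameter σ N) (N + 1)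
      (localGibbsProfile (fun _ => a) (fun _ => (0 : V3)) (fun _ => θr)) := by
    rw [canonicalPartition_eq_posPartition (a₀ := fun _ => a) (θ₀ := fun _ => θr)
      (u₀ := fun _ => (0 : V3)) continuous_const continuous_const continuous_const
      (fun _ => ha.le) (fun _ => hθr)]
    exact posPartition_pos continuous_const (fun _ => ha) hσ2 N
  unfold canonicalDensity
  rw [Set.indicator_of_mem hz]
  refine mul_pos (inv_pos.2 hZ) ?_
  unfold tensorPow localGibbsProfile
  exact Finset.prod_pos fun i _ => mul_pos ha (localMaxwellian_pos one_pos hθr _ _)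

/-- **The local Gibbs law has a density w.r.t. the homogeneous Gibbs law** (continuous profiles
`a₀ ≥ 0`, `θ₀ > 0`; reference `σ ≤ 1/2`, `a > 0`, `θr > 0`): the ratio of the two canonical
densities (the reference one is positive on the hard-sphere domain, off which both vanish). -/
theorem exists_density_localGibbsLaw (ha : Continuous a₀) (hθ : Continuous θ₀)
    (hu : Continuous u₀) {σ : ℝ} (hσ2 : σ ≤ 1 / 2) {a θr : ℝ}
    (ha' : 0 < a) (hθr : 0 < θr) (N : ℕ)
    (Φ : HardSphereFlow (Torus.geometry (Fin 3)) (hsDiameter σ N) (N + 1)) :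
    ∃ F : Config (N + 1) (Fin 3) T3 → ℝ≥0∞, Measurable F ∧
      localGibbsLaw σ a₀ u₀ θ₀ N Φ
        = (localGibbsLaw σ (fun _ => a) (fun _ => 0) (fun _ => θr) N Φ).withDensity F := by
  set ρl : Config (N + 1) (Fin 3) T3 → ℝ := canonicalDensity (Torus.geometry (Fin 3))
    (hsDiameter σ N) (N + 1) (localGibbsProfile a₀ u₀ θ₀) with hρl
  set ρG : Config (N + 1) (Fin 3) T3 → ℝ := canonicalDensity (Torus.geometry (Fin 3))
    (hsDiameter σ N) (N + 1) (localGibbsProfile (fun _ => a) (fun _ => (0 : V3)) (fun _ => θr))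
    with hρG
  have hρlm : Measurable ρl :=
    measurable_canonicalDensity _ _ (measurable_localGibbsProfile ha hθ hu)
  have hρGm : Measurable ρG :=
    measurable_canonicalDensity _ _
      (measurable_localGibbsProfile continuous_const continuous_const continuous_const)
  have hm1 : Measurable (fun z : Config (N + 1) (Fin 3) T3 => ENNReal.ofReal (ρG z)) :=
    hρGm.ennreal_ofReal
  have hm2 : Measurable (fun z : Config (N + 1) (Fin 3) T3 => ENNReal.ofReal (ρl z / ρG z)) :=
    (hρlm.div hρGm).ennreal_ofReal
  refine ⟨fun z => ENNReal.ofReal (ρl z / ρG z), hm2, ?_⟩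
  have hprod : volume.withDensity (fun z : Config (N + 1) (Fin 3) T3 => ENNReal.ofReal (ρl z)) =
      volume.withDensity ((fun z : Config (N + 1) (Fin 3) T3 => ENNReal.ofReal (ρG z)) *
        fun z => ENNReal.ofReal (ρl z / ρG z)) := by
    refine withDensity_congr_ae (Eventually.of_forall fun z => ?_)
    simp only [Pi.mul_apply]
    by_cases hz : z ∈ hardSphereDomain (Torus.geometry (Fin 3)) (N + 1) (hsDiameter σ N)
    · have hpos : 0 < ρG z := canonicalDensity_const_pos hσ2 ha' hθr N hz
      rw [← ENNReal.ofReal_mul hpos.le, mul_div_cancel₀ _ hpos.ne']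
    · have h1 : ρl z = 0 := canonicalDensity_eq_zero_of_notMem _ _ _ _ hz
      have h2 : ρG z = 0 := canonicalDensity_eq_zero_of_notMem _ _ _ _ hz
      simp [h1, h2]
  rw [localGibbsLaw_eq, localGibbsLaw_eq]
  show volume.withDensity (fun z => ENNReal.ofReal (ρl z)) =
    (volume.withDensity (fun z => ENNReal.ofReal (ρG z))).withDensity
      (fun z => ENNReal.ofReal (ρl z / ρG z))
  rw [hprod, withDensity_mul _ hm1 hm2]

/-! ## §3 Reflection symmetry of the centred Gaussian -/

/-- `∫ H(−w) N(0, θ I₃)(dw) = ∫ H(w) N(0, θ I₃)(dw)` for measurable `H ≥ 0` and `θ > 0` (the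
Maxwellian density is even and Lebesgue measure on `ℝ³` is reflection invariant). -/
theorem lintegral_comp_neg_gaussMeasure_zero {θ : ℝ} (hθ : 0 < θ) {H : V3 → ℝ≥0∞}
    (hH : Measurable H) :
    ∫⁻ w, H (-w) ∂(gaussMeasure (0 : V3) θ) = ∫⁻ w, H w ∂(gaussMeasure (0 : V3) θ) := by
  have hM : Measurable fun v : V3 => ENNReal.ofReal (localMaxwellian 1 θ (0 : V3) v) :=
    (continuous_localMaxwellian 1 θ (0 : V3)).measurable.ennreal_ofReal
  have heven : ∀ v : V3, localMaxwellian 1 θ (0 : V3) (-v) = localMaxwellian 1 θ (0 : V3) v := by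
    intro v
    simp [localMaxwellian, norm_neg]
  have hHn : Measurable (fun w : V3 => H (-w)) := hH.comp measurable_neg
  rw [← withDensity_localMaxwellian_eq_gaussMeasure hθ (0 : V3),
    lintegral_withDensity_eq_lintegral_mul _ hM hHn,
    lintegral_withDensity_eq_lintegral_mul _ hM hH]
  have hneg : MeasurePreserving (Neg.neg : V3 → V3) volume volume :=
    Measure.measurePreserving_neg (volume : Measure V3)
  have key := hneg.lintegral_comp_emb (MeasurableEquiv.neg V3).measurableEmbedding
    (fun v => ENNReal.ofReal (localMaxwellian 1 θ (0 : V3) v) * H v)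
  -- `key : ∫⁻ v, M(-v) * H(-v) = ∫⁻ v, M v * H v`
  calc ∫⁻ w, ((fun v => ENNReal.ofReal (localMaxwellian 1 θ (0 : V3) v)) * fun w => H (-w)) w
        = ∫⁻ v, ENNReal.ofReal (localMaxwellian 1 θ (0 : V3) (-v)) * H (-v) := by
          refine lintegral_congr fun v => ?_
          simp only [Pi.mul_apply, heven]
    _ = ∫⁻ v, ENNReal.ofReal (localMaxwellian 1 θ (0 : V3) v) * H v := key
    _ = ∫⁻ w, ((fun v => ENNReal.ofReal (localMaxwellian 1 θ (0 : V3) v)) * H) w := by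
          rfl

/-! ## §4 The registered audit stub: marginal envelope ⟺ exergy influence bound -/

/-- **Registered audit stub `stub_marginalEnvelope_iff`** of the line `IdeatorThreeSketch`: the
MARGINAL ENVELOPE (a Gaussian envelope `C·e^{β|w|²/2}N(0,θr)`, `βθr < 1`, of the one-particle
velocity marginals `E_{λ_N}[g(vᵢ(s))]` of the evolved local Gibbs law, uniformly in `N ≥ N₀`,
`s ≤ t`, in the crux's frame) is EQUIVALENT to the line's open stub `stub_exergyInfluence` (the
exergy influence bound, typed as a likelihood-ratio bound under the homogeneous invariant law).
`→`: shrink `σ₀` to `≤ 1/2`, take `a = 1` and `F = dλ_N/dG` (`exists_density_localGibbsLaw`), rewrite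
the tested functional as `E_{λ_N}[g(−vᵢ(s))]` (`lintegral_mul_density_flipVel_flow`), apply the
envelope to `g ∘ neg`, and undo the reflection on the Gaussian side
(`lintegral_comp_neg_gaussMeasure_zero`, `lintegral_vel_localGibbsLaw_const`).  `←`: the same three
identities read backwards. -/
theorem stub_marginalEnvelope_iff :
    (∀ (a₀ θ₀ : T3 → ℝ) (u₀ : T3 → V3), Continuous a₀ → Continuous θ₀ → Continuous u₀ →
      (∀ x, 0 < a₀ x) → (∀ x, 0 < θ₀ x) →
      ∃ σ₀ : ℝ, 0 < σ₀ ∧ ∀ σ : ℝ, 0 < σ → σ < σ₀ →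
        ∀ (T : ℝ) (ρ θ : ℝ → T3 → ℝ) (u : ℝ → T3 → V3), IsHardSphereEulerSolution σ T ρ u θ →
          ∀ Φ : (N : ℕ) → HardSphereFlow (Torus.geometry (Fin 3)) (hsDiameter σ N) (N + 1),
            TendstoHydroFieldsAt (fun N => localGibbsLaw σ a₀ u₀ θ₀ N (Φ N)) Φ ρ u θ 0 →
              ∀ t ∈ Set.Ico 0 T, ∃ θr β C : ℝ, 0 < θr ∧ β * θr < 1 ∧ 0 ≤ C ∧
                ∃ N₀ : ℕ, ∀ N : ℕ, N₀ ≤ N → ∀ s ∈ Set.Icc 0 t,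
                  ∀ (i : Fin (N + 1)) (g : V3 → ℝ≥0∞), Measurable g →
                    ∫⁻ z, g (((Φ N).flow s z i).2) ∂(localGibbsLaw σ a₀ u₀ θ₀ N (Φ N))
                      ≤ ENNReal.ofReal C *
                        ∫⁻ w, g w * ENNReal.ofReal (Real.exp (β * ‖w‖ ^ 2 / 2))
                          ∂(gaussMeasure (0 : V3) θr)) ↔
    (∀ (a₀ θ₀ : T3 → ℝ) (u₀ : T3 → V3), Continuous a₀ → Continuous θ₀ → Continuous u₀ →
      (∀ x, 0 < a₀ x) → (∀ x, 0 < θ₀ x) →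
      ∃ σ₀ : ℝ, 0 < σ₀ ∧ ∀ σ : ℝ, 0 < σ → σ < σ₀ →
        ∀ (T : ℝ) (ρ θ : ℝ → T3 → ℝ) (u : ℝ → T3 → V3), IsHardSphereEulerSolution σ T ρ u θ →
          ∀ Φ : (N : ℕ) → HardSphereFlow (Torus.geometry (Fin 3)) (hsDiameter σ N) (N + 1),
            TendstoHydroFieldsAt (fun N => localGibbsLaw σ a₀ u₀ θ₀ N (Φ N)) Φ ρ u θ 0 →
              ∀ t ∈ Set.Ico 0 T, ∃ a θr β C : ℝ, 0 < a ∧ 0 < θr ∧ β * θr < 1 ∧ 0 ≤ C ∧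
                ∃ N₀ : ℕ, ∀ N : ℕ, N₀ ≤ N → ∀ s ∈ Set.Icc 0 t,
                  ∃ F : Config (N + 1) (Fin 3) T3 → ℝ≥0∞, Measurable F ∧
                    localGibbsLaw σ a₀ u₀ θ₀ N (Φ N)
                      = (localGibbsLaw σ (fun _ => a) (fun _ => 0) (fun _ => θr) N (Φ N)).withDensity F ∧
                    ∀ (i : Fin (N + 1)) (g : V3 → ℝ≥0∞), Measurable g →
                      ∫⁻ z, g ((z i).2) * F (flipVel ((Φ N).flow s z))
                          ∂(localGibbsLaw σ (fun _ => a) (fun _ => 0) (fun _ => θr) N (Φ N))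
                        ≤ ENNReal.ofReal C *
                          ∫⁻ z, g ((z i).2) * ENNReal.ofReal (Real.exp (β * ‖(z i).2‖ ^ 2 / 2))
                            ∂(localGibbsLaw σ (fun _ => a) (fun _ => 0) (fun _ => θr) N (Φ N))) := by
  -- the tilting weight is measurable and even
  have hexpm : ∀ β : ℝ, Measurable fun w : V3 => ENNReal.ofReal (Real.exp (β * ‖w‖ ^ 2 / 2)) :=
    fun β => (((measurable_norm.pow_const 2).const_mul β).div_const 2).exp.ennreal_ofReal
  constructor
  · -- marginal envelope ⟹ exergy influence bound
    intro hME a₀ θ₀ u₀ ha hθ hu ha0 hθ0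
    obtain ⟨σ₀, hσ₀, H⟩ := hME a₀ θ₀ u₀ ha hθ hu ha0 hθ0
    refine ⟨min σ₀ (1 / 2), lt_min hσ₀ (by norm_num), ?_⟩
    intro σ hσ hσlt T ρ θ u hE Φ h0 t ht
    have hσ₀' : σ < σ₀ := lt_of_lt_of_le hσlt (min_le_left _ _)
    have hσ2 : σ ≤ 1 / 2 := (lt_of_lt_of_le hσlt (min_le_right _ _)).le
    obtain ⟨θr, β, C, hθr, hβ, hC, N₀, HN⟩ := H σ hσ hσ₀' T ρ θ u hE Φ h0 t ht
    refine ⟨1, θr, β, C, one_pos, hθr, hβ, hC, N₀, fun N hN s hs => ?_⟩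
    obtain ⟨F, hFm, hFeq⟩ := exists_density_localGibbsLaw ha hθ hu hσ2 (a := (1 : ℝ)) one_pos hθr
      N (Φ N)
    refine ⟨F, hFm, hFeq, fun i g hg => ?_⟩
    have hgn : Measurable fun w : V3 => g (-w) := hg.comp measurable_neg
    have hHm : Measurable (fun w : V3 => g w * ENNReal.ofReal (Real.exp (β * ‖w‖ ^ 2 / 2))) :=
      hg.mul (hexpm β)
    -- left side = E_λ[g(-vᵢ(s))]
    rw [lintegral_mul_density_flipVel_flow σ 1 θr N (Φ N) hFm hg s i, ← hFeq]
    -- right side = C · ∫ g e^{β|w|²/2} dN(0,θr)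
    rw [lintegral_vel_localGibbsLaw_const hσ2 one_pos hθr N (Φ N) i hHm]
    calc ∫⁻ w, g (-((Φ N).flow s w i).2) ∂(localGibbsLaw σ a₀ u₀ θ₀ N (Φ N))
        ≤ ENNReal.ofReal C * ∫⁻ w, g (-w) * ENNReal.ofReal (Real.exp (β * ‖w‖ ^ 2 / 2))
            ∂(gaussMeasure (0 : V3) θr) := HN N hN s hs i (fun w => g (-w)) hgn
      _ = ENNReal.ofReal C * ∫⁻ w, g w * ENNReal.ofReal (Real.exp (β * ‖w‖ ^ 2 / 2))
            ∂(gaussMeasure (0 : V3) θr) := by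
          congr 1
          have h := lintegral_comp_neg_gaussMeasure_zero hθr hHm
          simpa only [norm_neg] using h
  · -- exergy influence bound ⟹ marginal envelope
    intro hEX a₀ θ₀ u₀ ha hθ hu ha0 hθ0
    obtain ⟨σ₀, hσ₀, H⟩ := hEX a₀ θ₀ u₀ ha hθ hu ha0 hθ0
    refine ⟨min σ₀ (1 / 2), lt_min hσ₀ (by norm_num), ?_⟩
    intro σ hσ hσlt T ρ θ u hE Φ h0 t ht
    have hσ₀' : σ < σ₀ := lt_of_lt_of_le hσlt (min_le_left _ _)
    have hσ2 : σ ≤ 1 / 2 := (lt_of_lt_of_le hσlt (min_le_right _ _)).le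
    obtain ⟨a, θr, β, C, ha', hθr, hβ, hC, N₀, HN⟩ := H σ hσ hσ₀' T ρ θ u hE Φ h0 t ht
    refine ⟨θr, β, C, hθr, hβ, hC, N₀, fun N hN s hs i g hg => ?_⟩
    obtain ⟨F, hFm, hFeq, Hg⟩ := HN N hN s hs
    have hgn : Measurable fun w : V3 => g (-w) := hg.comp measurable_neg
    have hHm : Measurable (fun w : V3 => g w * ENNReal.ofReal (Real.exp (β * ‖w‖ ^ 2 / 2))) :=
      hg.mul (hexpm β)
    have hHn : Measurable (fun w : V3 => g (-w) * ENNReal.ofReal (Real.exp (β * ‖w‖ ^ 2 / 2))) :=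
      hgn.mul (hexpm β)
    have key := Hg i (fun w => g (-w)) hgn
    rw [lintegral_mul_density_flipVel_flow σ a θr N (Φ N) hFm hgn s i, ← hFeq,
      lintegral_vel_localGibbsLaw_const hσ2 ha' hθr N (Φ N) i hHn] at key
    simp only [neg_neg] at key
    calc ∫⁻ z, g (((Φ N).flow s z i).2) ∂(localGibbsLaw σ a₀ u₀ θ₀ N (Φ N))
        ≤ ENNReal.ofReal C * ∫⁻ w, g (-w) * ENNReal.ofReal (Real.exp (β * ‖w‖ ^ 2 / 2))
            ∂(gaussMeasure (0 : V3) θr) := key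
      _ = ENNReal.ofReal C * ∫⁻ w, g w * ENNReal.ofReal (Real.exp (β * ‖w‖ ^ 2 / 2))
            ∂(gaussMeasure (0 : V3) θr) := by
          congr 1
          have h := lintegral_comp_neg_gaussMeasure_zero hθr hHm
          simpa only [norm_neg] using h

end Summit.AtomisticToContinuum.HydrodynamicLimit.Theorems.LoschmidtTagging

end
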